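import Literature.NumberTheory.Sieve.ParityWave0
import Literature.NumberTheory.Sieve.ParityWave0Proofs
import Literature.NumberTheory.Sieve.CircleMethod
import HarnessLib

/-!
# Montgomery–Vaughan (1975): the exceptional set in Goldbach's problem

Objects, named sub-results and the PROVED final assembly of

* H. L. Montgomery, R. C. Vaughan, *The exceptional set in Goldbach's problem*, Acta Arith. 27
  (1975), 353–370 [MontgomeryVaughanActa1975], THEOREM 1 (p. 353): there is an (effectively
  computable) `δ > 0` with `E(X) < X^{1-δ}` for all large `X`, `E(X)` = number of even `n ≤ X` that
  are not a sum of two primes.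

This is the source of the named fact `Literature.NumberTheory.Sieve.goldbachExceptionalCount_isBigO_rpow`
(parity.S15, `Literature/NumberTheory/Sieve/ParityWave0.lean`). The printed proof is a whole theory
(circle method with the Deuring–Heilbronn phenomenon); this file decomposes it along the paper's own
numbering and proves the top of the DAG.

## The paper's architecture (journal page numbers)

* §2 (p. 355): parameters `P = X^{6δ}`, `Q = X^{1-6δ}` (2.4); `S(α) = ∑_{P < p ≤ X} (log p) e(pα)`
  (2.2); major arcs `𝔐(q, a) = [a/q - 1/(qQ), a/q + 1/(qQ)]`, `1 ≤ a ≤ q ≤ P`, `(a, q) = 1`, their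
  union `𝔐`, and the minor arcs `𝔪 = (Q⁻¹, 1 + Q⁻¹) ∖ 𝔐`.
* §3 (pp. 355–356): `R(n)` = coefficient of `e(αn)` in `S(α)²` (so `R(n) > 0 ⇒ n = p₁ + p₂`);
  (3.1) `R = R₁ + R₂` with `R₁ = ∫_𝔐 S(α)² e(-nα) dα`, `R₂ = ∫_𝔪 S(α)² e(-nα) dα`;
  (3.2) `∑_{n ≤ X} R₂(n)² ≪ X³ P⁻¹ (log X)³⁵`, from Parseval and (3.3)
  `max_𝔪 |S| ≪ X P^{-1/2} (log X)¹⁷`, itself from Dirichlet's approximation theorem and LEMMA 3.1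
  (Vinogradov's estimate for exponential sums over primes).
* §§4–7 (pp. 356–366): exceptional characters (Lemma 4.1, Davenport §14), Gallagher's Lemma 1
  (Lemma 4.2) and Gallagher's log-free prime number theorem Invent. Math. 11 (1970) Thm 7
  (Lemma 4.3), Gauss/Ramanujan sums (§5), the major-arc formulae (6.17), (6.17~), (6.21) and the
  error-term bound (7.1).
* §8 (pp. 367–368): `n` is a sum of two primes as soon as (8.1) `R₁(n) > |R₂(n)|`; by (3.2) at
  most `≪ X P^{-1/3} (log X)³⁵` integers `n ≤ X` have `|R₂(n)| > X P^{-1/3}`; (8.3)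
  `R₁(n) > X P^{-1/3}` for all even `n ∈ (X/2, X]` with `≪ X P^{-1/3}` exceptions; hence (8.2) at
  most `≪ X P^{-1/3} (log X)³⁵ = X^{1-2δ} (log X)³⁵` even `n ∈ (X/2, X]` are not sums of two primes,
  and "Theorem 1 is immediate" (dyadic summation).

## Contents

Objects (§§2–3, definitions with bodies): `primeWindow`, `expSum` (2.2), `majorArc`, `majorArcs`,
`minorArcs` (2.4 ff.), `coeffR` (`R(n)`), `majorArcIntegral` (`R₁`), `minorArcIntegral` (`R₂`)
(3.1).

Named facts (`def … : Prop`, cited, NOT proved here):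
* `vinogradov_expSum_bound` — LEMMA 3.1 in the textbook form of Nathanson, *Additive Number
  Theory: the Classical Bases*, Thm 8.5 (the input for (3.3));
* `minorArc_meanSquare` — (3.2);
* `majorArc_lowerBound` — (8.3) together with its exception count (the output of §§4–7 and of the
  case analysis of §8).

Proved here:
* `exists_prime_add_eq_of_coeffR_ne_zero`, `goldbachCount_ne_zero_of_coeffR_ne_zero` —
  `R(n) ≠ 0 ⇒ n = p₁ + p₂` with `P < pᵢ ≤ X` prime (§3, first sentence);
* `integral_expSum_sq` and `coeffR_eq_add` — orthogonality on `[Q⁻¹, 1 + Q⁻¹]` and (3.1);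
  `coeffR_pos_of_lt` — (8.1) `R₁(n) > |R₂(n)| ⇒ R(n) > 0`;
* `card_exceptionalWindow_le`, `card_exceptionalWindow_le_rpow` — the counting argument of §8:
  (3.2) ∧ (8.3) ⇒ (8.2);
* `Literature.NumberTheory.Sieve.le_mul_rpow_of_dyadic`, `Literature.NumberTheory.Sieve.goldbachExceptionalCount_le_half_add` — the
  dyadic summation ("Then Theorem 1 is immediate");
* `Literature.NumberTheory.Sieve.goldbachExceptionalCount_isBigO_rpow_of_montgomeryVaughan` —
  `minorArc_meanSquare → majorArc_lowerBound → goldbachExceptionalCount_isBigO_rpow`.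

What remains for `goldbachExceptionalCount_isBigO_rpow_holds` is exactly the discharge of the two
named facts (3.2) and (8.3); see the docstrings for their own inputs.

## Design choices

* All objects carry the cut-off `P` and the level `Q` as real parameters; the facts specialise to
  M–V's `P = X^{6δ}`, `Q = X^{1-6δ}`.
* `R(n)` is *defined* as the coefficient of `e(αn)` in `S(α)²` (a finite double sum over the prime
  window), exactly as in the paper; `R₁`, `R₂` are the set integrals over `𝔐`, `𝔪` (complex numbers;
  the paper remarks they are real — only real parts and norms are used below).
* The minor arcs are taken inside the CLOSED unit interval `[Q⁻¹, 1 + Q⁻¹]` (the paper writes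
  `Q⁻¹ < α < 1 + Q⁻¹`); the difference is the null set `{Q⁻¹, 1 + Q⁻¹}` and does not affect `R₂`,
  while it makes `𝔐 ⊆ [Q⁻¹, 1 + Q⁻¹]` (for `P + 1 ≤ Q`) literally true, so that (3.1) is an identity
  of set integrals.
* `e(x)` is Mathlib's `Real.fourierChar` (`𝐞`), as in `Literature/NumberTheory/Sieve/CircleMethod`.
-/

noncomputable section

open Filter Asymptotics Finset MeasureTheory
open scoped FourierTransform

namespace Literature.NumberTheory.Sieve.MontgomeryVaughan1975

/-! ### §2–§3: the objects -/

/-- The prime window `{p prime : P < p ≤ X}` over which M–V's sums (2.2), (2.3) run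
(Montgomery–Vaughan 1975, §2, (2.2)). [cite: MontgomeryVaughanActa1975, §2 (2.2)] -/
def primeWindow (P X : ℝ) : Finset ℕ :=
  (Nat.primesLE ⌊X⌋₊).filter fun p => P < p

/-- M–V's exponential sum `S(α) = ∑_{P < p ≤ X} (log p) e(pα)` (Montgomery–Vaughan 1975, (2.2)).
[cite: MontgomeryVaughanActa1975, §2 (2.2)] -/
def expSum (P X : ℝ) (α : ℝ) : ℂ :=
  ∑ p ∈ primeWindow P X, (Real.log p : ℂ) * (𝐞 (p * α) : ℂ)

/-- The major arc `𝔐(q, a) = [a/q - 1/(qQ), a/q + 1/(qQ)]` (Montgomery–Vaughan 1975, §2, after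
(2.4)). [cite: MontgomeryVaughanActa1975, §2 (2.4)] -/
def majorArc (Q : ℝ) (q a : ℕ) : Set ℝ :=
  Set.Icc ((a : ℝ) / q - 1 / (q * Q)) ((a : ℝ) / q + 1 / (q * Q))

/-- The major arcs `𝔐 = ⋃_{1 ≤ a ≤ q ≤ P, (a,q)=1} 𝔐(q, a)` (Montgomery–Vaughan 1975, §2, after
(2.4)). [cite: MontgomeryVaughanActa1975, §2 (2.4)] -/
def majorArcs (P Q : ℝ) : Set ℝ :=
  ⋃ q ∈ Finset.Icc 1 ⌊P⌋₊, ⋃ a ∈ (Finset.Icc 1 q).filter (fun a => a.Coprime q), majorArc Q q a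

/-- The minor arcs `𝔪 = [Q⁻¹, 1 + Q⁻¹] ∖ 𝔐` (Montgomery–Vaughan 1975, §2, end: the `α`,
`Q⁻¹ < α < 1 + Q⁻¹`, not lying in `𝔐`; the closed interval used here differs from theirs by the null
set of the two endpoints). [cite: MontgomeryVaughanActa1975, §2 (2.4)] -/
def minorArcs (P Q : ℝ) : Set ℝ :=
  Set.Icc Q⁻¹ (1 + Q⁻¹) \ majorArcs P Q

/-- `R(n)`, the coefficient of `e(αn)` in `S(α)²`:
`R(n) = ∑_{P < p₁, p₂ ≤ X, p₁ + p₂ = n} (log p₁)(log p₂)` (Montgomery–Vaughan 1975, §3, first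
paragraph). [cite: MontgomeryVaughanActa1975, §3 (3.1)] -/
def coeffR (P X : ℝ) (n : ℕ) : ℝ :=
  ∑ p₁ ∈ primeWindow P X, ∑ p₂ ∈ primeWindow P X,
    if p₁ + p₂ = n then Real.log p₁ * Real.log p₂ else 0

/-- `R₁(n) = ∫_𝔐 S(α)² e(-nα) dα`, the major-arc part (Montgomery–Vaughan 1975, (3.1)).
[cite: MontgomeryVaughanActa1975, §3 (3.1)] -/
def majorArcIntegral (P Q X : ℝ) (n : ℕ) : ℂ :=
  ∫ α in majorArcs P Q, expSum P X α ^ 2 * (𝐞 (-(n * α)) : ℂ)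

/-- `R₂(n) = ∫_𝔪 S(α)² e(-nα) dα`, the minor-arc part (Montgomery–Vaughan 1975, (3.1)).
[cite: MontgomeryVaughanActa1975, §3 (3.1)] -/
def minorArcIntegral (P Q X : ℝ) (n : ℕ) : ℂ :=
  ∫ α in minorArcs P Q, expSum P X α ^ 2 * (𝐞 (-(n * α)) : ℂ)

/-! ### Named facts (inputs not proved here) -/

/-- NAMED FACT — **Vinogradov's estimate for exponential sums over primes**, in the textbook
form with Vaughan's exponents (Nathanson, *Additive Number Theory: the Classical Bases*, GTM 164
(1996), Theorem 8.5, p. 220, for `F(α) = ∑_{p ≤ N} (log p) e(pα)` = `Literature.primeExpSumLog N α`):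
if `a, q` are integers with `1 ≤ q ≤ N`, `(a, q) = 1` and `|α - a/q| ≤ 1/q²`, then
`F(α) ≪ (N q^{-1/2} + N^{4/5} + N^{1/2} q^{1/2}) (log N)⁴` with an absolute implied constant.
This is the input LEMMA 3.1 of Montgomery–Vaughan 1975 ("essentially a consequence of Theorems 1
and 3 of Vinogradov, Chapter IX"; "Recently Vaughan [19] discovered a very simple proof"): their
form is the case `Y ≤ q ≤ X/Y`, `Y ≤ X^{1/4}`, `S(α) ≪ X Y^{-1/2} (log X)^{17}` for the window
`P < p ≤ X`, and it feeds (3.3) and hence `minorArc_meanSquare`. Not in Mathlib.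
[cite: Nathanson1996, Theorem 8.5, p. 220] -/
def vinogradov_expSum_bound : Prop :=
  ∃ C : ℝ, ∀ (N : ℕ), 2 ≤ N → ∀ (α : ℝ) (a : ℤ) (q : ℕ), 1 ≤ q → q ≤ N → IsCoprime a (q : ℤ) →
    |α - a / q| ≤ 1 / (q : ℝ) ^ 2 →
      ‖Literature.NumberTheory.Sieve.primeExpSumLog N α‖ ≤
        C * ((N : ℝ) / Real.sqrt q + (N : ℝ) ^ (4 / 5 : ℝ) + Real.sqrt N * Real.sqrt q) *
          Real.log N ^ 4

/-- NAMED FACT — **minor-arc mean square** (Montgomery–Vaughan 1975, (3.2), p. 356): with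
`P = X^{6δ}`, `Q = X^{1-6δ}`, for `δ` sufficiently small and `X ≥ X₀(δ)`,
`∑_{n ≤ X} R₂(n)² ≪ X³ P⁻¹ (log X)³⁵` (implied constant absolute, as are all implicit constants of
the paper, §2). Printed proof: Parseval twice
(`∑_n R₂(n)² = ∫_𝔪 |S|⁴ ≤ (max_𝔪 |S|)² ∫ |S|² ≪ (max_𝔪 |S|)² X log X`) and (3.3)
`max_𝔪 |S(α)| ≪ X P^{-1/2} (log X)^{17}`, which follows from Dirichlet's approximation theorem and
Lemma 3.1 (`vinogradov_expSum_bound`) with `Y = P ≤ X^{1/4}`. Not in Mathlib.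
[cite: MontgomeryVaughanActa1975, §3 (3.2)] -/
def minorArc_meanSquare : Prop :=
  ∃ δ₀ : ℝ, 0 < δ₀ ∧ ∃ C : ℝ, ∀ δ : ℝ, 0 < δ → δ ≤ δ₀ → ∃ X₀ : ℝ, ∀ X : ℝ, X₀ ≤ X →
    ∑ n ∈ Finset.Icc 1 ⌊X⌋₊,
        ‖minorArcIntegral (X ^ (6 * δ)) (X ^ (1 - 6 * δ)) X n‖ ^ 2 ≤
      C * X ^ 3 * (X ^ (6 * δ))⁻¹ * Real.log X ^ 35

/-- NAMED FACT — **major-arc lower bound off a small exceptional set** (Montgomery–Vaughan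
1975, (8.3) and the sentence containing it, p. 367): with `P = X^{6δ}`, `Q = X^{1-6δ}`, for `δ`
sufficiently small and `X ≥ X₀(δ)`, `R₁(n) > X P^{-1/3}` for all even `n`, `X/2 < n ≤ X`, with the
exception of `≪ X P^{-1/3}` values of `n` (implied constant absolute; `R₁(n)` is real, and the
statement is recorded for its real part). This is the deep half of the paper: it rests on the
zero-free region with at most one exceptional real zero and the Deuring–Heilbronn bound
(Lemma 4.1 = Davenport §14), Gallagher's log-free prime number theorem for arithmetic
progressions (Lemma 4.3 = Gallagher, Invent. Math. 11 (1970), Thm 7), the Gauss–Ramanujan-sum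
identities of §5, the major-arc formulae (6.17), (6.17~), (6.21), the bound (7.1) for the error
terms `W`, and the case analysis of §8 ((8.4)–(8.6)). Not in Mathlib.
[cite: MontgomeryVaughanActa1975, §8 (8.3)] -/
def majorArc_lowerBound : Prop :=
  ∃ δ₀ : ℝ, 0 < δ₀ ∧ ∃ C : ℝ, ∀ δ : ℝ, 0 < δ → δ ≤ δ₀ → ∃ X₀ : ℝ, ∀ X : ℝ, X₀ ≤ X →
    (((Finset.Icc 1 ⌊X⌋₊).filter fun n : ℕ => X / 2 < n ∧ Even n ∧
        (majorArcIntegral (X ^ (6 * δ)) (X ^ (1 - 6 * δ)) X n).re ≤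
          X * (X ^ (6 * δ)) ^ (-(1 / 3 : ℝ))).card : ℝ) ≤
      C * X * (X ^ (6 * δ)) ^ (-(1 / 3 : ℝ))

/-! ### §3, first paragraph: `R(n) > 0 ⇒ n` is a sum of two primes -/

/-- Members of the prime window are prime (definition). [folklore] -/
theorem prime_of_mem_primeWindow {P X : ℝ} {p : ℕ} (hp : p ∈ primeWindow P X) : p.Prime :=
  Nat.prime_of_mem_primesLE (Finset.mem_filter.mp hp).1

/-- `R(n) ≥ 0`: every term `(log p₁)(log p₂)` is nonnegative. [folklore] -/
theorem coeffR_nonneg (P X : ℝ) (n : ℕ) : 0 ≤ coeffR P X n := by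
  refine Finset.sum_nonneg fun p₁ _ => Finset.sum_nonneg fun p₂ _ => ?_
  split_ifs
  · exact mul_nonneg (Real.log_natCast_nonneg _) (Real.log_natCast_nonneg _)
  · exact le_rfl

/-- "We note that if `R(n) > 0` then `n` is a sum of two primes" (Montgomery–Vaughan 1975, §3,
first paragraph): a nonzero coefficient of `S(α)²` exhibits primes `P < p₁, p₂ ≤ X` with
`p₁ + p₂ = n`. [cite: MontgomeryVaughanActa1975, §3 (3.1)] -/
theorem exists_prime_add_eq_of_coeffR_ne_zero {P X : ℝ} {n : ℕ} (h : coeffR P X n ≠ 0) :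
    ∃ p₁ p₂ : ℕ, p₁.Prime ∧ p₂.Prime ∧ p₁ + p₂ = n := by
  by_contra hne
  push Not at hne
  refine h (Finset.sum_eq_zero fun p₁ hp₁ => Finset.sum_eq_zero fun p₂ hp₂ => ?_)
  rw [if_neg (hne p₁ p₂ (prime_of_mem_primeWindow hp₁) (prime_of_mem_primeWindow hp₂))]

/-- With `R(N) = goldbachCount N` the number of ordered prime pairs: `R(n) ≠ 0` forces
`goldbachCount n ≠ 0` (Montgomery–Vaughan 1975, §3, first paragraph, in the currency of
`Literature.NumberTheory.Sieve.ParityWave0.goldbachCount`). [cite: MontgomeryVaughanActa1975, §3 (3.1)] -/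
theorem goldbachCount_ne_zero_of_coeffR_ne_zero {P X : ℝ} {n : ℕ} (h : coeffR P X n ≠ 0) :
    Literature.NumberTheory.Sieve.ParityWave0.goldbachCount n ≠ 0 := by
  rw [Ne, Literature.NumberTheory.Sieve.goldbachCount_eq_zero_iff, not_not]
  exact exists_prime_add_eq_of_coeffR_ne_zero h

/-! ### (3.1): `R(n) = R₁(n) + R₂(n)` -/

/-- The major arcs lie inside `[Q⁻¹, 1 + Q⁻¹]` as soon as `P + 1 ≤ Q` (Montgomery–Vaughan 1975, §2:
for `1 ≤ a ≤ q ≤ P`, `a/q - 1/(qQ) ≥ (Q - 1)/(qQ) ≥ 1/Q` and `a/q + 1/(qQ) ≤ 1 + 1/Q`).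
[cite: MontgomeryVaughanActa1975, §2 (2.4)] -/
theorem majorArcs_subset_Icc {P Q : ℝ} (hQ : 0 < Q) (hPQ : P + 1 ≤ Q) :
    majorArcs P Q ⊆ Set.Icc Q⁻¹ (1 + Q⁻¹) := by
  intro α hα
  simp only [majorArcs, Set.mem_iUnion, Finset.mem_Icc, Finset.mem_filter, exists_prop] at hα
  obtain ⟨q, ⟨hq1, hqP⟩, a, ⟨⟨ha1, haq⟩, -⟩, hαl, hαr⟩ := hα
  have hP1 : 1 ≤ P := by
    have : 0 < ⌊P⌋₊ := lt_of_lt_of_le Nat.zero_lt_one (hq1.trans hqP)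
    exact Nat.floor_pos.mp this
  have hq : (1 : ℝ) ≤ q := by exact_mod_cast hq1
  have hq0 : (0 : ℝ) < q := by linarith
  have hqle : (q : ℝ) ≤ P := (Nat.cast_le.mpr hqP).trans (Nat.floor_le (by linarith))
  have ha : (1 : ℝ) ≤ a := by exact_mod_cast ha1
  have haq' : (a : ℝ) ≤ q := by exact_mod_cast haq
  have hqQ : (0 : ℝ) < q * Q := mul_pos hq0 hQ
  constructor
  · -- `Q⁻¹ ≤ a/q - 1/(qQ)`
    calc Q⁻¹ = q / (q * Q) := by field_simp
      _ ≤ (a * Q - 1) / (q * Q) := by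
          apply div_le_div_of_nonneg_right _ hqQ.le
          nlinarith
      _ = (a : ℝ) / q - 1 / (q * Q) := by field_simp
      _ ≤ α := hαl
  · -- `a/q + 1/(qQ) ≤ 1 + Q⁻¹`
    calc α ≤ (a : ℝ) / q + 1 / (q * Q) := hαr
      _ ≤ 1 + Q⁻¹ := by
          have h1 : (a : ℝ) / q ≤ 1 := (div_le_one hq0).mpr haq'
          have h2 : 1 / (q * Q) ≤ Q⁻¹ := by
            rw [one_div, mul_inv]
            calc (q : ℝ)⁻¹ * Q⁻¹ ≤ 1 * Q⁻¹ :=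
                mul_le_mul_of_nonneg_right (inv_le_one_of_one_le₀ hq) (inv_nonneg.mpr hQ.le)
              _ = Q⁻¹ := one_mul _
          linarith

/-- The major arcs form a measurable set (a finite union of closed intervals). [folklore] -/
theorem measurableSet_majorArcs (P Q : ℝ) : MeasurableSet (majorArcs P Q) :=
  MeasurableSet.biUnion (Finset.countable_toSet _) fun _ _ =>
    MeasurableSet.biUnion (Finset.countable_toSet _) fun _ _ => measurableSet_Icc

/-- Orthogonality over a unit interval placed anywhere: `∫_c^{c+1} e(kα) dα = [k = 0]` for `k ∈ ℤ`
(Montgomery–Vaughan 1975 integrate over `Q⁻¹ < α < 1 + Q⁻¹`; cf.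
`Literature.NumberTheory.Sieve.integral_fourierChar_intCast_holds` for `c = 0`). For `k ≠ 0` the primitive `e(kα)/(2πik)` is
`1`-periodic. [folklore] -/
theorem integral_fourierChar_intCast_unitInterval (k : ℤ) (c : ℝ) :
    ∫ α in c..c + 1, (𝐞 (k * α) : ℂ) = if k = 0 then 1 else 0 := by
  simp_rw [Real.fourierChar_apply]
  split_ifs with hk
  · subst hk; simp
  · have hc : (2 * Real.pi * k * Complex.I : ℂ) ≠ 0 := by
      simp [Real.pi_ne_zero, hk]
    have h : ∀ α : ℝ, Complex.exp (↑(2 * Real.pi * (k * α)) * Complex.I) =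
        Complex.exp ((2 * Real.pi * k * Complex.I) * α) := by
      intro α; congr 1; push_cast; ring
    simp_rw [h, integral_exp_mul_complex hc]
    have h1 : Complex.exp (2 * Real.pi * k * Complex.I * ((c : ℂ) + 1)) =
        Complex.exp (2 * Real.pi * k * Complex.I * (c : ℂ)) := by
      rw [show (2 * Real.pi * k * Complex.I * ((c : ℂ) + 1)) =
          2 * Real.pi * k * Complex.I * (c : ℂ) + k * (2 * Real.pi * Complex.I) by ring,
        Complex.exp_add, Complex.exp_int_mul_two_pi_mul_I, mul_one]
    have h2 : ((c + 1 : ℝ) : ℂ) = (c : ℂ) + 1 := by push_cast; rfl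
    rw [h2, h1, sub_self, zero_div]

/-- `∫_c^{c+1} S(α)² e(-nα) dα = R(n)`: `R(n)` is the coefficient of `e(αn)` in the trigonometric
polynomial `S(α)²` (Montgomery–Vaughan 1975, §3, first paragraph; orthogonality
`integral_fourierChar_intCast_unitInterval`). [cite: MontgomeryVaughanActa1975, §3 (3.1)] -/
theorem integral_expSum_sq (P X c : ℝ) (n : ℕ) :
    ∫ α in c..c + 1, expSum P X α ^ 2 * (𝐞 (-(n * α)) : ℂ) = coeffR P X n := by
  set F := primeWindow P X with hF
  have hI : ∀ α : ℝ, expSum P X α ^ 2 * (𝐞 (-(n * α)) : ℂ) =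
      ∑ p₁ ∈ F, ∑ p₂ ∈ F,
        (Real.log p₁ : ℂ) * Real.log p₂ * (𝐞 (((p₁ + p₂ - n : ℤ)) * α) : ℂ) := by
    intro α
    rw [expSum, ← hF, sq, Finset.sum_mul_sum, Finset.sum_mul]
    refine Finset.sum_congr rfl fun p₁ _ => ?_
    rw [Finset.sum_mul]
    refine Finset.sum_congr rfl fun p₂ _ => ?_
    have harg : (((2 * Real.pi * ((p₁ + p₂ - n : ℤ) * α) : ℝ) : ℂ) * Complex.I) =
        ((2 * Real.pi * (p₁ * α) : ℝ) : ℂ) * Complex.I + ((2 * Real.pi * (p₂ * α) : ℝ) : ℂ) *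
          Complex.I + ((2 * Real.pi * (-(n * α)) : ℝ) : ℂ) * Complex.I := by
      push_cast
      ring
    simp only [Real.fourierChar_apply]
    rw [harg, Complex.exp_add, Complex.exp_add]
    ring
  simp_rw [hI]
  have hcont : ∀ p₁ p₂ : ℕ, IntervalIntegrable
      (fun α : ℝ => (Real.log p₁ : ℂ) * Real.log p₂ * (𝐞 (((p₁ + p₂ - n : ℤ)) * α) : ℂ))
      volume c (c + 1) := by
    intro p₁ p₂
    apply Continuous.intervalIntegrable
    fun_prop
  rw [intervalIntegral.integral_finsetSum fun p₁ _ =>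
    Continuous.intervalIntegrable (by fun_prop) _ _]
  rw [Finset.sum_congr rfl fun p₁ _ => intervalIntegral.integral_finsetSum fun p₂ _ => hcont p₁ p₂]
  simp_rw [intervalIntegral.integral_const_mul, integral_fourierChar_intCast_unitInterval]
  rw [coeffR, ← hF, Complex.ofReal_sum]
  refine Finset.sum_congr rfl fun p₁ _ => ?_
  rw [Complex.ofReal_sum]
  refine Finset.sum_congr rfl fun p₂ _ => ?_
  have hiff : ((p₁ + p₂ - n : ℤ) = 0) ↔ p₁ + p₂ = n := by omega
  by_cases hpn : p₁ + p₂ = n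
  · rw [if_pos (hiff.mpr hpn), if_pos hpn, mul_one, Complex.ofReal_mul]
  · rw [if_neg (mt hiff.mp hpn), if_neg hpn, mul_zero, Complex.ofReal_zero]

/-- The integrand `S(α)² e(-nα)` is continuous in `α`. [folklore] -/
theorem continuous_expSum_sq_mul (P X : ℝ) (n : ℕ) :
    Continuous fun α : ℝ => expSum P X α ^ 2 * (𝐞 (-(n * α)) : ℂ) := by
  unfold expSum
  fun_prop

/-- **(3.1)** `R(n) = R₁(n) + R₂(n)` (Montgomery–Vaughan 1975, (3.1)): for `0 < Q` and `P + 1 ≤ Q`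
the major arcs lie in `[Q⁻¹, 1 + Q⁻¹]`, so the integral over that unit interval — which is `R(n)`
by `integral_expSum_sq` — splits as `∫_𝔐 + ∫_𝔪`. [cite: MontgomeryVaughanActa1975, §3 (3.1)] -/
theorem coeffR_eq_add {P Q : ℝ} (X : ℝ) (n : ℕ) (hQ : 0 < Q) (hPQ : P + 1 ≤ Q) :
    (coeffR P X n : ℂ) = majorArcIntegral P Q X n + minorArcIntegral P Q X n := by
  have hsub := majorArcs_subset_Icc hQ hPQ
  have hint : IntegrableOn (fun α : ℝ => expSum P X α ^ 2 * (𝐞 (-(n * α)) : ℂ))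
      (Set.Icc Q⁻¹ (1 + Q⁻¹)) volume :=
    (continuous_expSum_sq_mul P X n).integrableOn_Icc
  rw [majorArcIntegral, minorArcIntegral, minorArcs,
    setIntegral_sdiff (measurableSet_majorArcs P Q) hint hsub, add_sub_cancel,
    integral_Icc_eq_integral_Ioc, ← intervalIntegral.integral_of_le (by linarith),
    show (1 : ℝ) + Q⁻¹ = Q⁻¹ + 1 from add_comm _ _, integral_expSum_sq]

/-- Real form of (3.1) used in §8: `R(n) = Re R₁(n) + Re R₂(n) ≥ Re R₁(n) - |R₂(n)|`, so
(8.1) `Re R₁(n) > |R₂(n)|` forces `R(n) > 0` (Montgomery–Vaughan 1975, §8, (8.1)).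
[cite: MontgomeryVaughanActa1975, §8 (8.1)] -/
theorem coeffR_pos_of_lt {P Q : ℝ} (X : ℝ) (n : ℕ) (hQ : 0 < Q) (hPQ : P + 1 ≤ Q)
    (h : ‖minorArcIntegral P Q X n‖ < (majorArcIntegral P Q X n).re) : 0 < coeffR P X n := by
  have hre := congrArg Complex.re (coeffR_eq_add X n hQ hPQ)
  rw [Complex.ofReal_re, Complex.add_re] at hre
  have h2 : -‖minorArcIntegral P Q X n‖ ≤ (minorArcIntegral P Q X n).re :=
    (abs_le.mp (Complex.abs_re_le_norm _)).1
  linarith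

/-! ### §8: the counting argument, (3.2) ∧ (8.3) ⇒ (8.2) -/

/-- The set counted in (8.2): even `n` with `X/2 < n ≤ X` that are not a sum of two primes
(`goldbachCount n = 0`) (Montgomery–Vaughan 1975, §8, (8.2)).
[cite: MontgomeryVaughanActa1975, §8 (8.2)] -/
def exceptionalWindow (X : ℝ) : Finset ℕ :=
  (Finset.Icc 1 ⌊X⌋₊).filter fun n : ℕ => X / 2 < n ∧ Even n ∧ Literature.NumberTheory.Sieve.ParityWave0.goldbachCount n = 0

/-- Parameter bookkeeping for (3.1): `X^a + 1 ≤ X^{1-a}` for `X ≥ 4` and `0 ≤ a ≤ 1/4` (so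
`P + 1 ≤ Q` for `P = X^{6δ}`, `Q = X^{1-6δ}`, `6δ ≤ 1/4`). [folklore] -/
theorem rpow_add_one_le_rpow_one_sub {X a : ℝ} (hX : 4 ≤ X) (ha0 : 0 ≤ a) (ha : a ≤ 1 / 4) :
    X ^ a + 1 ≤ X ^ (1 - a) := by
  have hX0 : 0 < X := by linarith
  have hX1 : 1 ≤ X := by linarith
  have h1 : 1 ≤ X ^ a := Real.one_le_rpow hX1 ha0
  have h2 : (2 : ℝ) ≤ X ^ (1 / 2 : ℝ) := by
    rw [← Real.sqrt_eq_rpow]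
    calc (2 : ℝ) = √4 := by
          rw [show (4 : ℝ) = 2 ^ 2 by norm_num, Real.sqrt_sq zero_le_two]
      _ ≤ √X := Real.sqrt_le_sqrt hX
  have h3 : X ^ (1 / 2 : ℝ) ≤ X ^ (1 - 2 * a) :=
    Real.rpow_le_rpow_of_exponent_le hX1 (by linarith)
  have h4 : X ^ (1 - a) = X ^ a * X ^ (1 - 2 * a) := by
    rw [← Real.rpow_add hX0]; ring_nf
  rw [h4]
  nlinarith

/-- **§8, first half of p. 367** (Montgomery–Vaughan 1975): (3.2) and (8.3) give (8.2). With
`P = X^{6δ}`, `T = X P^{-1/3}`: by (3.2) and Chebyshev's inequality at most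
`C₁ X P^{-1/3} (log X)³⁵`
integers `n ≤ X` have `|R₂(n)| > T`; by (8.3) at most `C₂ X P^{-1/3}` even `n ∈ (X/2, X]` have
`R₁(n) ≤ T`; every other even `n ∈ (X/2, X]` has `R₁(n) > T ≥ |R₂(n)|`, hence `R(n) > 0` by (3.1),
hence is a sum of two primes. So the number of even non-Goldbach `n ∈ (X/2, X]` is at most
`(C₁ (log X)³⁵ + C₂) X P^{-1/3} = (C₁ (log X)³⁵ + C₂) X^{1-2δ}` for `X ≥ X₀(δ)`, `δ` small.
[cite: MontgomeryVaughanActa1975, §8 (8.2)] -/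
theorem card_exceptionalWindow_le (h32 : minorArc_meanSquare) (h83 : majorArc_lowerBound) :
    ∃ δ : ℝ, 0 < δ ∧ δ ≤ 1 / 24 ∧ ∃ C₁ C₂ X₀ : ℝ, 0 ≤ C₁ ∧ 0 ≤ C₂ ∧ ∀ X : ℝ, X₀ ≤ X →
      ((exceptionalWindow X).card : ℝ) ≤ (C₁ * Real.log X ^ 35 + C₂) * X ^ (1 - 2 * δ) := by
  obtain ⟨δ₁, hδ₁, C₁, h1⟩ := h32
  obtain ⟨δ₂, hδ₂, C₂, h2⟩ := h83
  set δ : ℝ := min (min δ₁ δ₂) (1 / 24) with hδ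
  have hδ0 : 0 < δ := lt_min (lt_min hδ₁ hδ₂) (by norm_num)
  have hδle₁ : δ ≤ δ₁ := (min_le_left _ _).trans (min_le_left _ _)
  have hδle₂ : δ ≤ δ₂ := (min_le_left _ _).trans (min_le_right _ _)
  have hδ24 : δ ≤ 1 / 24 := min_le_right _ _
  obtain ⟨X₁, hX₁⟩ := h1 δ hδ0 hδle₁
  obtain ⟨X₂, hX₂⟩ := h2 δ hδ0 hδle₂
  refine ⟨δ, hδ0, hδ24, max C₁ 0, max C₂ 0, max (max X₁ X₂) 4, le_max_right _ _, le_max_right _ _,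
    fun X hX => ?_⟩
  have hXX₁ : X₁ ≤ X := ((le_max_left _ _).trans (le_max_left _ _)).trans hX
  have hXX₂ : X₂ ≤ X := ((le_max_right _ _).trans (le_max_left _ _)).trans hX
  have hX4 : 4 ≤ X := (le_max_right _ _).trans hX
  have hX0 : 0 < X := by linarith
  -- the parameters
  set P : ℝ := X ^ (6 * δ) with hP
  set Q : ℝ := X ^ (1 - 6 * δ) with hQ
  set u : ℝ := P ^ (-(1 / 3 : ℝ)) with hu
  have hP0 : 0 < P := Real.rpow_pos_of_pos hX0 _
  have hQ0 : 0 < Q := Real.rpow_pos_of_pos hX0 _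
  have hu0 : 0 < u := Real.rpow_pos_of_pos hP0 _
  have hPQ : P + 1 ≤ Q := rpow_add_one_le_rpow_one_sub hX4 (by linarith) (by linarith)
  have hXu : X * u = X ^ (1 - 2 * δ) := by
    rw [hu, hP, ← Real.rpow_mul hX0.le, show 6 * δ * -(1 / 3 : ℝ) = -(2 * δ) by ring,
      sub_eq_add_neg, Real.rpow_add hX0, Real.rpow_one]
  have hPu : P⁻¹ = u ^ 3 := by
    rw [hu, ← Real.rpow_natCast, ← Real.rpow_mul hP0.le]; norm_num [Real.rpow_neg_one]
  -- the two bad sets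
  set R₁ := fun n : ℕ => majorArcIntegral P Q X n with hR₁
  set R₂ := fun n : ℕ => minorArcIntegral P Q X n with hR₂
  set B₁ : Finset ℕ := (Finset.Icc 1 ⌊X⌋₊).filter fun n : ℕ => X * u < ‖R₂ n‖ with hB₁
  set B₂ : Finset ℕ := (Finset.Icc 1 ⌊X⌋₊).filter fun n : ℕ =>
    X / 2 < n ∧ Even n ∧ (R₁ n).re ≤ X * u with hB₂
  have h32X : ∑ n ∈ Finset.Icc 1 ⌊X⌋₊, ‖R₂ n‖ ^ 2 ≤ C₁ * X ^ 3 * P⁻¹ * Real.log X ^ 35 :=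
    hX₁ X hXX₁
  have h83X : (B₂.card : ℝ) ≤ C₂ * X * u := hX₂ X hXX₂
  -- (8.1): outside `B₁ ∪ B₂` every even `n ∈ (X/2, X]` is a sum of two primes
  have hsub : exceptionalWindow X ⊆ B₁ ∪ B₂ := by
    intro n hn
    rw [exceptionalWindow, Finset.mem_filter] at hn
    obtain ⟨hnI, hnX, hne, hgc⟩ := hn
    rw [Finset.mem_union]
    by_contra hnot
    rw [not_or, hB₁, hB₂, Finset.mem_filter, Finset.mem_filter, not_and, not_and, not_lt] at hnot
    have hle : ‖R₂ n‖ ≤ X * u := hnot.1 hnI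
    have hgt : X * u < (R₁ n).re := by
      have := hnot.2 hnI
      by_contra hcon
      exact this ⟨hnX, hne, not_lt.mp hcon⟩
    exact goldbachCount_ne_zero_of_coeffR_ne_zero
      (coeffR_pos_of_lt X n hQ0 hPQ (hle.trans_lt hgt)).ne' hgc
  -- Chebyshev on (3.2): `#B₁ (Xu)² ≤ ∑ |R₂|² ≤ C₁ X³ P⁻¹ (log X)³⁵ = (C₁ X u (log X)³⁵) (Xu)²`
  have hB₁card : (B₁.card : ℝ) ≤ max C₁ 0 * X * u * Real.log X ^ 35 := by
    have hcheb : (B₁.card : ℝ) * (X * u) ^ 2 ≤ ∑ n ∈ B₁, ‖R₂ n‖ ^ 2 := by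
      rw [← nsmul_eq_mul]
      refine Finset.card_nsmul_le_sum B₁ (fun n => ‖R₂ n‖ ^ 2) _ fun n hn => ?_
      have hlt : X * u < ‖R₂ n‖ := (Finset.mem_filter.mp hn).2
      exact pow_le_pow_left₀ (mul_pos hX0 hu0).le hlt.le 2
    have hmono : ∑ n ∈ B₁, ‖R₂ n‖ ^ 2 ≤ ∑ n ∈ Finset.Icc 1 ⌊X⌋₊, ‖R₂ n‖ ^ 2 :=
      Finset.sum_le_sum_of_subset_of_nonneg (Finset.filter_subset _ _) fun _ _ _ => sq_nonneg _
    have hlog : 0 ≤ Real.log X ^ 35 := pow_nonneg (Real.log_nonneg (by linarith)) _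
    have hC : C₁ * X ^ 3 * P⁻¹ * Real.log X ^ 35 ≤ max C₁ 0 * X ^ 3 * P⁻¹ * Real.log X ^ 35 := by
      have hXP : 0 ≤ X ^ 3 * P⁻¹ * Real.log X ^ 35 :=
        mul_nonneg (mul_nonneg (pow_nonneg hX0.le _) (inv_nonneg.2 hP0.le)) hlog
      calc C₁ * X ^ 3 * P⁻¹ * Real.log X ^ 35 = C₁ * (X ^ 3 * P⁻¹ * Real.log X ^ 35) := by ring
        _ ≤ max C₁ 0 * (X ^ 3 * P⁻¹ * Real.log X ^ 35) :=
            mul_le_mul_of_nonneg_right (le_max_left _ _) hXP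
        _ = max C₁ 0 * X ^ 3 * P⁻¹ * Real.log X ^ 35 := by ring
    have key : (B₁.card : ℝ) * (X * u) ^ 2 ≤ (max C₁ 0 * X * u * Real.log X ^ 35) * (X * u) ^ 2 :=
      calc (B₁.card : ℝ) * (X * u) ^ 2 ≤ C₁ * X ^ 3 * P⁻¹ * Real.log X ^ 35 :=
            hcheb.trans (hmono.trans h32X)
        _ ≤ max C₁ 0 * X ^ 3 * P⁻¹ * Real.log X ^ 35 := hC
        _ = (max C₁ 0 * X * u * Real.log X ^ 35) * (X * u) ^ 2 := by rw [hPu]; ring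
    exact le_of_mul_le_mul_right key (pow_pos (mul_pos hX0 hu0) 2)
  have hB₂card : (B₂.card : ℝ) ≤ max C₂ 0 * X * u :=
    h83X.trans (by gcongr; exact le_max_left _ _)
  calc ((exceptionalWindow X).card : ℝ) ≤ ((B₁ ∪ B₂).card : ℝ) := by
        exact_mod_cast Finset.card_le_card hsub
    _ ≤ (B₁.card : ℝ) + B₂.card := by exact_mod_cast Finset.card_union_le B₁ B₂
    _ ≤ max C₁ 0 * X * u * Real.log X ^ 35 + max C₂ 0 * X * u := add_le_add hB₁card hB₂card
    _ = (max C₁ 0 * Real.log X ^ 35 + max C₂ 0) * X ^ (1 - 2 * δ) := by rw [← hXu]; ring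

/-- (8.2) with the logarithm absorbed: for some `η ∈ (0, 1)` and all `X ≥ X₀`, at most `X^{1-η}`
even `n ∈ (X/2, X]` are not sums of two primes (from `card_exceptionalWindow_le`, since
`(log X)³⁵ = o(X^δ)`). [cite: MontgomeryVaughanActa1975, §8 (8.2)] -/
theorem card_exceptionalWindow_le_rpow (h32 : minorArc_meanSquare) (h83 : majorArc_lowerBound) :
    ∃ η : ℝ, 0 < η ∧ η < 1 ∧ ∃ X₀ : ℝ, ∀ X : ℝ, X₀ ≤ X →
      ((exceptionalWindow X).card : ℝ) ≤ X ^ (1 - η) := by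
  obtain ⟨δ, hδ0, hδ24, C₁, C₂, X₀, hC₁, hC₂, h⟩ := card_exceptionalWindow_le h32 h83
  -- eventually `C₁ (log X)³⁵ + C₂ ≤ X^δ`
  have hev : ∀ᶠ X : ℝ in atTop, C₁ * Real.log X ^ 35 + C₂ ≤ X ^ δ := by
    have hlo := isLittleO_log_rpow_rpow_atTop (35 : ℝ) hδ0
    have h1 : ∀ᶠ X : ℝ in atTop, C₁ * Real.log X ^ 35 ≤ X ^ δ / 2 := by
      have hc : (0 : ℝ) < 1 / (2 * (C₁ + 1)) := by positivity
      filter_upwards [hlo.bound hc, eventually_ge_atTop (1 : ℝ)] with X hX hX1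
      have hL : 0 ≤ Real.log X ^ (35 : ℝ) := Real.rpow_nonneg (Real.log_nonneg hX1) _
      have hXδ : 0 ≤ X ^ δ := Real.rpow_nonneg (by linarith) _
      rw [Real.norm_of_nonneg hL, Real.norm_of_nonneg hXδ] at hX
      rw [← Real.rpow_natCast, Nat.cast_ofNat]
      calc C₁ * Real.log X ^ (35 : ℝ) ≤ C₁ * (1 / (2 * (C₁ + 1)) * X ^ δ) :=
            mul_le_mul_of_nonneg_left hX hC₁
        _ = (C₁ / (C₁ + 1)) * (X ^ δ / 2) := by
            have hC1 : (C₁ + 1) ≠ 0 := by positivity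
            field_simp
        _ ≤ 1 * (X ^ δ / 2) := by
            apply mul_le_mul_of_nonneg_right _ (by linarith)
            rw [div_le_one (by linarith)]; linarith
        _ = X ^ δ / 2 := one_mul _
    have h2 : ∀ᶠ X : ℝ in atTop, C₂ ≤ X ^ δ / 2 := by
      have := (tendsto_rpow_atTop hδ0).eventually_ge_atTop (2 * C₂)
      filter_upwards [this] with X hX
      linarith
    filter_upwards [h1, h2] with X hX1 hX2
    linarith
  obtain ⟨X₁, hX₁⟩ := Filter.eventually_atTop.mp hev
  refine ⟨δ, hδ0, by linarith, max (max X₀ X₁) 1, fun X hX => ?_⟩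
  have hXX₀ : X₀ ≤ X := ((le_max_left _ _).trans (le_max_left _ _)).trans hX
  have hXX₁ : X₁ ≤ X := ((le_max_right _ _).trans (le_max_left _ _)).trans hX
  have hX1 : 1 ≤ X := (le_max_right _ _).trans hX
  have hX0 : 0 < X := by linarith
  calc ((exceptionalWindow X).card : ℝ) ≤ (C₁ * Real.log X ^ 35 + C₂) * X ^ (1 - 2 * δ) :=
        h X hXX₀
    _ ≤ X ^ δ * X ^ (1 - 2 * δ) :=
        mul_le_mul_of_nonneg_right (hX₁ X hXX₁) (Real.rpow_nonneg hX0.le _)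
    _ = X ^ (1 - δ) := by rw [← Real.rpow_add hX0]; ring_nf

end Literature.NumberTheory.Sieve.MontgomeryVaughan1975

/-! ### "Then Theorem 1 is immediate": dyadic summation and the final assembly -/

namespace Literature.NumberTheory.Sieve

open MontgomeryVaughan1975

/-- Dyadic summation (the step "Then Theorem 1 is immediate", Montgomery–Vaughan 1975, §8): if
`f(x) ≤ f(⌊x/2⌋) + K x^θ` for `x ≥ x₀ ≥ 2` (`θ > 0`, `K ≥ 0`) and `f ≤ B` below `x₀`, then
`f(x) ≤ M x^θ` for all `x ≥ 1`, with `M = max(B, 0) + K/(1 - 2^{-θ})`. [folklore] -/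
theorem le_mul_rpow_of_dyadic {f : ℕ → ℝ} {θ K B : ℝ} {x₀ : ℕ} (hθ : 0 < θ) (hK : 0 ≤ K)
    (hx₀ : 2 ≤ x₀) (hB : ∀ x, x < x₀ → f x ≤ B)
    (hrec : ∀ x, x₀ ≤ x → f x ≤ f (x / 2) + K * (x : ℝ) ^ θ) :
    ∃ M : ℝ, 0 ≤ M ∧ ∀ x : ℕ, 1 ≤ x → f x ≤ M * (x : ℝ) ^ θ := by
  set r : ℝ := (2 : ℝ) ^ (-θ) with hr
  have hr0 : 0 < r := Real.rpow_pos_of_pos two_pos _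
  have hr1 : r < 1 := Real.rpow_lt_one_of_one_lt_of_neg one_lt_two (neg_neg_of_pos hθ)
  have hKr : 0 ≤ K / (1 - r) := div_nonneg hK (by linarith)
  set M : ℝ := max B 0 + K / (1 - r) with hM
  have hM0 : 0 ≤ M := add_nonneg (le_max_right _ _) hKr
  have hKM : K ≤ M * (1 - r) := by
    have : K / (1 - r) ≤ M := le_add_of_nonneg_left (le_max_right _ _)
    rwa [div_le_iff₀ (by linarith)] at this
  refine ⟨M, hM0, fun x => ?_⟩
  induction x using Nat.strong_induction_on with
  | _ x ih =>
    intro hx1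
    have hxpos : (0 : ℝ) < x := by exact_mod_cast hx1
    rcases lt_or_ge x x₀ with hlt | hge
    · calc f x ≤ B := hB x hlt
        _ ≤ M := (le_max_left _ _).trans (le_add_of_nonneg_right hKr)
        _ ≤ M * (x : ℝ) ^ θ :=
            le_mul_of_one_le_right hM0 (Real.one_le_rpow (by exact_mod_cast hx1) hθ.le)
    · have hx2 : 1 ≤ x / 2 := (Nat.le_div_iff_mul_le two_pos).2 (by omega)
      have hlt' : x / 2 < x := Nat.div_lt_self (by omega) one_lt_two
      have ih' : f (x / 2) ≤ M * ((x / 2 : ℕ) : ℝ) ^ θ := ih (x / 2) hlt' hx2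
      have hpow : ((x / 2 : ℕ) : ℝ) ^ θ ≤ r * (x : ℝ) ^ θ := by
        calc ((x / 2 : ℕ) : ℝ) ^ θ ≤ ((x : ℝ) / 2) ^ θ :=
              Real.rpow_le_rpow (Nat.cast_nonneg _) Nat.cast_div_le hθ.le
          _ = r * (x : ℝ) ^ θ := by
              rw [Real.div_rpow hxpos.le zero_le_two, hr, Real.rpow_neg zero_le_two,
                div_eq_mul_inv, mul_comm]
      calc f x ≤ f (x / 2) + K * (x : ℝ) ^ θ := hrec x hge
        _ ≤ M * ((x / 2 : ℕ) : ℝ) ^ θ + K * (x : ℝ) ^ θ := by linarith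
        _ ≤ M * (r * (x : ℝ) ^ θ) + K * (x : ℝ) ^ θ := by gcongr
        _ = (M * r + K) * (x : ℝ) ^ θ := by ring
        _ ≤ M * (x : ℝ) ^ θ := by
            apply mul_le_mul_of_nonneg_right _ (Real.rpow_nonneg hxpos.le _)
            linarith

/-- `E(x) ≤ E(⌊x/2⌋) + #{even n ∈ (x/2, x] : n is not a sum of two primes}`: an exceptional
`N ≤ x` either satisfies `N ≤ ⌊x/2⌋` or lies in M–V's window `(x/2, x]` (Montgomery–Vaughan 1975,
§8, "Then Theorem 1 is immediate"). [cite: MontgomeryVaughanActa1975, §8 (8.2)] -/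
theorem goldbachExceptionalCount_le_half_add (x : ℕ) :
    goldbachExceptionalCount x ≤
      goldbachExceptionalCount (x / 2) + (exceptionalWindow (x : ℝ)).card := by
  classical
  rw [goldbachExceptionalCount, goldbachExceptionalCount]
  refine (Finset.card_le_card fun N hN => ?_).trans (Finset.card_union_le _ _)
  rw [Finset.mem_filter, Finset.mem_range] at hN
  obtain ⟨hNx, hNe, hN4, hNg⟩ := hN
  rw [Finset.mem_union]
  by_cases hhalf : N ≤ x / 2
  · left
    exact Finset.mem_filter.mpr ⟨Finset.mem_range.mpr (Nat.lt_succ_of_le hhalf), hNe, hN4, hNg⟩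
  · right
    rw [exceptionalWindow, Finset.mem_filter, Finset.mem_Icc, Nat.floor_natCast]
    refine ⟨⟨by omega, Nat.le_of_lt_succ hNx⟩, ?_, hNe, hNg⟩
    have h2 : x < N * 2 := (Nat.div_lt_iff_lt_mul two_pos).mp (not_le.mp hhalf)
    have h2' : (x : ℝ) < N * 2 := by exact_mod_cast h2
    linarith

/-- **Assembly of Montgomery–Vaughan 1975, Theorem 1** from the two analytic inputs: the
minor-arc mean square (3.2) (`minorArc_meanSquare`) and the major-arc lower bound (8.3)
(`majorArc_lowerBound`) imply `E(x) ≪ x^{1-δ}` for some `δ > 0` — parity.S15,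
`goldbachExceptionalCount_isBigO_rpow`. Proof: §8's counting (`card_exceptionalWindow_le_rpow`)
bounds the exceptional even `n ∈ (X/2, X]` by `X^{1-η}` for `X ≥ X₀`, and dyadic summation
(`le_mul_rpow_of_dyadic` with `E(x) ≤ E(⌊x/2⌋) + X^{1-η}`, `E(x) ≤ x + 1` below `X₀`) gives
`E(x) ≤ M x^{1-η}` for all `x ≥ 1`. [cite: MontgomeryVaughanActa1975, Theorem 1 and §8] -/
theorem goldbachExceptionalCount_isBigO_rpow_of_montgomeryVaughan
    (h32 : minorArc_meanSquare) (h83 : majorArc_lowerBound) :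
    goldbachExceptionalCount_isBigO_rpow := by
  obtain ⟨η, hη0, hη1, X₀, hX₀⟩ := card_exceptionalWindow_le_rpow h32 h83
  set x₀ : ℕ := max ⌈X₀⌉₊ 2 with hx₀
  have hx₀2 : 2 ≤ x₀ := le_max_right _ _
  set f : ℕ → ℝ := fun x => (goldbachExceptionalCount x : ℝ) with hf
  have hB : ∀ x, x < x₀ → f x ≤ x₀ := by
    intro x hx
    have h1 : goldbachExceptionalCount x ≤ x + 1 :=
      (Finset.card_filter_le _ _).trans (Finset.card_range _).le
    calc f x = (goldbachExceptionalCount x : ℝ) := rfl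
      _ ≤ (x + 1 : ℕ) := by exact_mod_cast h1
      _ ≤ x₀ := by exact_mod_cast hx
  have hrec : ∀ x, x₀ ≤ x → f x ≤ f (x / 2) + 1 * (x : ℝ) ^ (1 - η) := by
    intro x hx
    have hxX : X₀ ≤ (x : ℝ) :=
      (Nat.le_ceil X₀).trans (by exact_mod_cast (le_max_left _ _).trans hx)
    have h1 := goldbachExceptionalCount_le_half_add x
    have h2 := hX₀ (x : ℝ) hxX
    calc f x = (goldbachExceptionalCount x : ℝ) := rfl
      _ ≤ (goldbachExceptionalCount (x / 2) : ℝ) + ((exceptionalWindow (x : ℝ)).card : ℝ) := by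
          exact_mod_cast h1
      _ ≤ f (x / 2) + 1 * (x : ℝ) ^ (1 - η) := by rw [one_mul]; exact add_le_add le_rfl h2
  obtain ⟨M, hM0, hM⟩ :=
    le_mul_rpow_of_dyadic (by linarith : 0 < 1 - η) zero_le_one hx₀2 hB hrec
  refine ⟨η, hη0, IsBigO.of_bound M ?_⟩
  filter_upwards [eventually_ge_atTop 1] with x hx
  rw [Real.norm_of_nonneg (Nat.cast_nonneg _),
    Real.norm_of_nonneg (Real.rpow_nonneg (Nat.cast_nonneg _) _)]
  exact hM x hx

end Literature.NumberTheory.Sieve
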